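import Summits.QuantumFields.YangMills.Theorems.BalabanUVNodesN15KingModelLandauFlux
import Summits.QuantumFields.YangMills.Theorems.BalabanUVNodesN15KingModelCurvatureTranslations
import HarnessLib

/-!
# BalabanUVNodes ∕ N15 — THE KING-MODEL RUNG (PART Ϸ-a): CONSTANT LINK FIELDS — THE VECTOR PLANCHEREL ON KING's TORUS AND THE EXACT `n × n` SYMBOL PER MOMENTUM OF THE COVARIANT
# FINE OPERATOR `−cΔ_W + m²` AT ANY CONSTANT UNITARY LINKS `U(x,μ) = W_μ` (commuting or not): `Re⟨v,(−cΔ_W+m²)v⟩ = Σ_q [m²‖v̂_q‖² + cΣ_μ‖(1 − e^{iq′_μ}W_μ)v̂_q‖²]`; fibre coercivity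
# IS torus coercivity (Track A, DAG node N15 = NE2; FAN-OUT v1.1 §N15 s3 «KING-MODEL RUNG … + what the curved case adds»; count-neutral)

HONEST FRAMING.  Count-neutral (cell `pub-ymgap`, seat `pub-ymgap-dag-n15-e` g48; `--supports stmt-QuantumFields-27247 --as helper` = K3ᴬ, KEY MAP v3).  King's fine covariance layer
`−cΔ_U + m²` (PART Ͱ-a `covLapF`; [Balaban1985BackgroundPropagators] (3.23) p.394, [King1986] (4.4) p.670) at a CONSTANT link field on ONE finite torus `T = Π_μℤ∕K_μ`; exact finite
identities; NOT Bałaban's `G_k(U)` (no block term), NOT [Balaban1985BackgroundPropagators] (3.42); NOT a node discharge (N15 of record untouched); nothing continuum ∕ ℝ⁴ ∕ OS ∕ Clay.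

THE POINT OF PART Ϸ.  PARTS Ϳ∕Ϡ treated ABELIAN curvature (`U(1)` flux, Landau gauge: NOT translation invariant).  A CONSTANT non-abelian link field `U(x,μ) = W_μ ∈ U(n)` is translation
invariant and nevertheless CURVED as soon as the `W_μ` do not commute (plaquette `W_μW_νW_μ^*W_ν^* ≠ 1`): the simplest genuinely non-abelian background («a non-abelian toron with
curvature», door (t3⁵³) of the desk).  Translation invariance makes King's plane waves `χ_q(x) = e^{iq′·x}` ([King1986] (4.35) p.674; tree `B5Prop11Plancherel.chi`, [Balaban1984PropagatorsI]
(1.29) p.23) block-diagonalise `−cΔ_W + m²` into `|T|` Hermitian `n × n` FIBRES.  THIS FILE is the engine (any fibre `ℂⁿ`, any constant unitary links); PART Ϸ-b∕c∕d decide the Pauli pair.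

THE RESULTS (`K` any period vector, all `K_μ ≥ 1`; `W : Fin(d+1) → U(n)`; `ψ_μ(q) = χ_q(e_μ) = e^{iq′_μ}`, `q′_μ = 2π·valMinAbs(q_μ)∕K_μ` = tree `sOf`):
* §1 `kingConstLink W (x,μ) := W_μ`; unitary; `kingTransLink_kingConstLink` (translation invariant, PART Ϳ-o's `kingTransLink`);
* §2 THE VECTOR DFT `vhat v (q,i) := Σ_x F(q,x)·v(x,i)` (`F` = tree `dft`, unitary): ★ **`sum_norm_fib_vhat_sq`** (PLANCHEREL `Σ_q‖v̂_q‖² = Σ_x‖v_x‖²`, componentwise from Ͱ-b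
  `norm_toEuclideanLin_of_mem_unitaryGroup`), ★ `vhat_shift` (`(v(·+e_μ))^(q) = ψ_μ(q)·v̂(q)`, tree `dft_sub_unitVec`), `vhat_constMulVec` (a constant matrix commutes with the DFT), `vhat_sub`;
* §3 ★★ **`sum_norm_bond_sq_eq_fibre`** — ONE DIRECTION IN MOMENTUM SPACE: `Σ_x‖v_x − W·v_{x+e_μ}‖² = Σ_q‖v̂_q − ψ_μ(q)·W·v̂_q‖²` (any matrix `W`);
  ★★★ **`re_quadForm_covLapF_kingConstLink_eq_fibre`** — THE EXACT SYMBOL: `Re⟨v,(−cΔ_W+m²)v⟩ = Σ_q (m²‖v̂_q‖² + cΣ_μ‖v̂_q − ψ_μ(q)W_μv̂_q‖²)` (Ͱ-d's covariant Dirichlet form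
  `re_quadForm_covLapF`, transformed);
* §4 ★★ **`coercive_covLapF_kingConstLink_of_fibre`** — a FIBREWISE bound `κ‖ξ‖² ≤ m²‖ξ‖² + cΣ_μ‖ξ − ψ_μ(q)W_μξ‖²` for all `q ∈ T̂`, `ξ ∈ ℂⁿ` gives `κ·Σ_x‖v_x‖² ≤ Re⟨v,(−cΔ_W+m²)v⟩`
  on the torus; hence (PART Ϡ-c's engines BY NAME) ★ `eigenvalues_covLapF_kingConstLink_ge_of_fibre`, ★ `posDef_covLapF_kingConstLink_of_fibre`, ★ `l2_opNorm_covLapF_kingConstLink_inv_le_of_fibre`.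
WHAT THE CURVED CASE ADDS (read in PART Ϸ-c): at `W ≡ 1` the fibre is King's symbol `m² + cΣ_μ|1 − e^{iq′_μ}|² = m² + cΣ_μ(2 − 2cos q′_μ)` ([King1986] (4.4)) times `1ₙ`, bottom `m²` at `q = 0`;
non-commuting `W_μ` have no common fixed vector at any momentum, and the bottom LIFTS (quantified for the Pauli pair in Ϸ-c, sharp in Ϸ-d).
PRIOR TREE ART (by name, not restated): Ͱ-a (`covLapF`), Ͱ-b (`fib`, `fib_apply`, `norm_toEuclideanLin_of_mem_unitaryGroup`), Ͱ-d (`re_quadForm_covLapF`), Ͱ-f (`sum_norm_fib_sq`), Ϡ-c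
(`eigenvalues_covLapF_ge_of_coercive`, `posDef_covLapF_of_coercive`, `l2_opNorm_covLapF_inv_le_of_coercive`), Ϳ-o (`kingTransLink`), `B5Prop11Plancherel` (`Tor`, `unitVec`, `chi`, `dft`,
`dft_mem_unitaryGroup`, `dft_sub_unitVec`, `chi_unitVec`), Mathlib (`EuclideanSpace.norm_sq_eq`, `Matrix.toLpLin_apply`).  Dedup (rg at filing): basename 0 files; needles
`kingConstLink|vhat|sum_norm_bond_sq_eq_fibre|_kingConstLink_` 0 tree files.  Locators: [King1986] (4.4) p.670, (4.35) p.674; [Balaban1984PropagatorsI] (1.29) p.23; [Balaban1985BackgroundPropagators]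
(3.3) p.391, (3.23) p.394.  0 `sorry`, 2 `def`.
-/

noncomputable section

open scoped BigOperators ComplexConjugate ComplexOrder InnerProductSpace
open Finset Matrix WithLp

namespace Summit.QuantumFields.YangMills.BalabanUVNodes.N15KingModelRung.ConstantCurvature

open Literature.MathematicalPhysics.QuantumFieldTheory.Balaban1983to89.B5Prop11Plancherel (Tor unitVec chi dft chi_unitVec dft_sub_unitVec dft_mem_unitaryGroup)
open Summit.QuantumFields.YangMills.BalabanUVNodes.N15KingModelRung.Covariant (covLapF fib fib_apply isHermitian_covLapF re_quadForm_covLapF sum_norm_fib_sq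
  norm_toEuclideanLin_of_mem_unitaryGroup)
open Summit.QuantumFields.YangMills.BalabanUVNodes.N15KingModelRung.Landau (eigenvalues_covLapF_ge_of_coercive posDef_covLapF_of_coercive l2_opNorm_covLapF_inv_le_of_coercive)
open Summit.QuantumFields.YangMills.BalabanUVNodes.N15KingModelRung.Curvature (kingTransLink)

variable {d : ℕ} (K : Fin (d + 1) → ℕ)

/-! ## §1 Constant link fields -/

section ConstLink

variable {𝕜 : Type*} {n : Type*}

/-- THE CONSTANT LINK FIELD `U(x,μ) = W_μ` of a family of `n × n` matrices indexed by the directions (unitary in the applications; the `W_μ` need NOT commute).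
[cite: Balaban1985BackgroundPropagators, (3.3) p.391; King1986, (4.4) p.670] -/
def kingConstLink (W : Fin (d + 1) → Matrix n n 𝕜) : Tor K × Fin (d + 1) → Matrix n n 𝕜 := fun b => W b.2

/-- `U(x,μ) = W_μ`. [folklore] -/
@[simp] theorem kingConstLink_apply (W : Fin (d + 1) → Matrix n n 𝕜) (x : Tor K) (μ : Fin (d + 1)) : kingConstLink K W (x, μ) = W μ := rfl

/-- A constant link field of unitary matrices is a unitary link field. [folklore] -/
theorem kingConstLink_mem_unitaryGroup [RCLike 𝕜] [Fintype n] [DecidableEq n] {W : Fin (d + 1) → Matrix n n 𝕜} (hW : ∀ μ, W μ ∈ Matrix.unitaryGroup n 𝕜) (b : Tor K × Fin (d + 1)) :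
    kingConstLink K W b ∈ Matrix.unitaryGroup n 𝕜 := hW b.2

/-- ★ A constant link field is TRANSLATION INVARIANT: `U(· + t, μ) = U(·, μ)` (PART Ϳ-o's `kingTransLink`). [folklore] -/
theorem kingTransLink_kingConstLink (t : Tor K) (W : Fin (d + 1) → Matrix n n 𝕜) : kingTransLink K t (kingConstLink K W) = kingConstLink K W := rfl

end ConstLink

/-! ## §2 The vector discrete Fourier transform on the torus -/

section VectorDFT

variable [hK : ∀ μ, NeZero (K μ)] {n : Type*} [Fintype n] [DecidableEq n]

/-- THE VECTOR DFT of `v : T × n → ℂ`: `v̂(q,i) = Σ_x F(q,x)·v(x,i)` with the tree's unitary DFT matrix `F(q,x) = |T|^{−1∕2}·conj χ_q(x)` — King's plane-wave analysis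
([King1986] (4.35)) applied to each fibre component. [cite: King1986, (4.35) p.674; Balaban1984PropagatorsI, (1.29) p.23] -/
def vhat (v : Tor K × n → ℂ) : Tor K × n → ℂ := fun p => ∑ x, dft K p.1 x * v (x, p.2)

omit [Fintype n] [DecidableEq n] in
/-- Componentwise the vector DFT is the tree's DFT: `v̂(·,i) = F·v(·,i)`. [cite: Balaban1984PropagatorsI, (1.29) p.23] -/
theorem vhat_apply (v : Tor K × n → ℂ) (q : Tor K) (i : n) : vhat K v (q, i) = (dft K *ᵥ fun x => v (x, i)) q := rfl

omit [Fintype n] [DecidableEq n] in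
/-- Linearity: `(v − w)^ = v̂ − ŵ`. [folklore] -/
theorem vhat_sub (v w : Tor K × n → ℂ) : vhat K (v - w) = vhat K v - vhat K w := by
  funext p
  simp only [vhat, Pi.sub_apply, mul_sub, Finset.sum_sub_distrib]

omit [DecidableEq n] hK in
/-- `‖v_x‖² = Σ_i |v(x,i)|²` (the fibre norm of PART Ͱ-b). [folklore] -/
theorem norm_fib_sq_eq_sum (v : Tor K × n → ℂ) (x : Tor K) : ‖fib K v x‖ ^ 2 = ∑ i, ‖v (x, i)‖ ^ 2 := by
  rw [EuclideanSpace.norm_sq_eq]; rfl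

omit [DecidableEq n] in
/-- ★ **THE VECTOR PLANCHEREL THEOREM**: `Σ_q‖v̂_q‖² = Σ_x‖v_x‖²` (the DFT is unitary on every component). [cite: Balaban1984PropagatorsI, (1.29) p.23; King1986, (4.35) p.674] -/
theorem sum_norm_fib_vhat_sq (v : Tor K × n → ℂ) : ∑ q, ‖fib K (vhat K v) q‖ ^ 2 = ∑ x, ‖fib K v x‖ ^ 2 := by
  simp only [norm_fib_sq_eq_sum]
  rw [Finset.sum_comm, Finset.sum_comm (f := fun x i => ‖v (x, i)‖ ^ 2)]
  refine Finset.sum_congr rfl fun i _ => ?_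
  have hu := norm_toEuclideanLin_of_mem_unitaryGroup (dft_mem_unitaryGroup K) (toLp 2 fun x => v (x, i))
  rw [Matrix.toLpLin_apply, ofLp_toLp] at hu
  have h2 := congrArg (fun r : ℝ => r ^ 2) hu
  simp only [EuclideanSpace.norm_sq_eq] at h2
  exact h2

omit [Fintype n] [DecidableEq n] in
/-- ★ **THE SHIFT THEOREM**: `(v(· + e_μ))^(q,i) = ψ_μ(q)·v̂(q,i)` with `ψ_μ(q) = χ_q(e_μ) = e^{iq′_μ}`. [cite: King1986, (4.35) p.674; Balaban1984PropagatorsI, (1.29) p.23] -/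
theorem vhat_shift (v : Tor K × n → ℂ) (μ : Fin (d + 1)) (q : Tor K) (i : n) :
    vhat K (fun p => v (p.1 + unitVec K μ, p.2)) (q, i) = chi K q (unitVec K μ) * vhat K v (q, i) := by
  unfold vhat
  simp only
  rw [Finset.mul_sum, Fintype.sum_equiv (Equiv.addRight (unitVec K μ)) (fun x => dft K q x * v (x + unitVec K μ, i))
    (fun y => dft K q (y - unitVec K μ) * v (y, i)) (fun x => by simp only [Equiv.coe_addRight, add_sub_cancel_right])]
  refine Finset.sum_congr rfl fun y _ => ?_
  rw [dft_sub_unitVec, chi_unitVec, mul_assoc]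

omit [DecidableEq n] in
/-- A CONSTANT matrix acting on the fibres COMMUTES with the DFT: `(W·v)^(q) = W·v̂(q)`. [folklore] -/
theorem vhat_constMulVec (W : Matrix n n ℂ) (v : Tor K × n → ℂ) (q : Tor K) (i : n) :
    vhat K (fun p => (W *ᵥ fun j => v (p.1, j)) p.2) (q, i) = (W *ᵥ fun j => vhat K v (q, j)) i := by
  simp only [vhat, Matrix.mulVec, dotProduct, Finset.mul_sum]
  rw [Finset.sum_comm]
  refine Finset.sum_congr rfl fun j _ => Finset.sum_congr rfl fun x _ => ?_
  ring

end VectorDFT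

/-! ## §3 The covariant Dirichlet form of a constant link field in momentum space -/

section Fibre

variable [hK : ∀ μ, NeZero (K μ)] {n : Type*} [Fintype n] [DecidableEq n]

omit hK in
/-- The bond difference `v_x − W·v_{x+e_μ}` is the fibre of the field `x ↦ v(x,·) − W·v(x+e_μ,·)`. [folklore] -/
theorem fib_bondField (W : Matrix n n ℂ) (v : Tor K × n → ℂ) (μ : Fin (d + 1)) (x : Tor K) :
    fib K (v - fun p => (W *ᵥ fun j => v (p.1 + unitVec K μ, j)) p.2) x
      = fib K v x - Matrix.toEuclideanLin W (fib K v (x + unitVec K μ)) := by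
  rw [Matrix.toLpLin_apply]
  rfl

/-- … and its DFT has fibre `v̂_q − ψ_μ(q)·W·v̂_q`. [cite: King1986, (4.35) p.674] -/
theorem fib_vhat_bondField (W : Matrix n n ℂ) (v : Tor K × n → ℂ) (μ : Fin (d + 1)) (q : Tor K) :
    fib K (vhat K (v - fun p => (W *ᵥ fun j => v (p.1 + unitVec K μ, j)) p.2)) q
      = fib K (vhat K v) q - chi K q (unitVec K μ) • Matrix.toEuclideanLin W (fib K (vhat K v) q) := by
  rw [vhat_sub, Matrix.toLpLin_apply]
  ext i
  have h1 : vhat K (fun p => (W *ᵥ fun j => v (p.1 + unitVec K μ, j)) p.2) (q, i) = chi K q (unitVec K μ) * (W *ᵥ fun j => vhat K v (q, j)) i := by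
    have := vhat_constMulVec K W (fun p => v (p.1 + unitVec K μ, p.2)) q i
    simp only at this
    rw [this]
    have h2 : (fun j => vhat K (fun p => v (p.1 + unitVec K μ, p.2)) (q, j)) = fun j => chi K q (unitVec K μ) * vhat K v (q, j) := by
      funext j; exact vhat_shift K v μ q j
    rw [h2]
    simp only [Matrix.mulVec, dotProduct, Finset.mul_sum]
    refine Finset.sum_congr rfl fun j _ => by ring
  simp only [fib_apply, Pi.sub_apply, PiLp.sub_apply, PiLp.smul_apply, smul_eq_mul, h1]
  rfl

/-- ★★ **ONE DIRECTION IN MOMENTUM SPACE**: `Σ_x‖v_x − W·v_{x+e_μ}‖² = Σ_q‖v̂_q − ψ_μ(q)·W·v̂_q‖²` for every matrix `W` (constant along the torus) — Plancherel + the shift theorem.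
[cite: King1986, (4.35) p.674; Balaban1985BackgroundPropagators, (3.3) p.391] -/
theorem sum_norm_bond_sq_eq_fibre (W : Matrix n n ℂ) (v : Tor K × n → ℂ) (μ : Fin (d + 1)) :
    ∑ x, ‖fib K v x - Matrix.toEuclideanLin W (fib K v (x + unitVec K μ))‖ ^ 2
      = ∑ q, ‖fib K (vhat K v) q - chi K q (unitVec K μ) • Matrix.toEuclideanLin W (fib K (vhat K v) q)‖ ^ 2 := by
  simp only [← fib_bondField, ← fib_vhat_bondField]
  exact (sum_norm_fib_vhat_sq K _).symm

/-- ★★★ **THE EXACT SYMBOL OF `−cΔ_W + m²` AT CONSTANT UNITARY LINKS**: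
`Re⟨v,(−cΔ_W+m²)v⟩ = Σ_q (m²‖v̂_q‖² + c·Σ_μ‖v̂_q − ψ_μ(q)·W_μ·v̂_q‖²)` — King's plane waves block-diagonalise the covariant Dirichlet form (PART Ͱ-d) into `|T|` Hermitian `n × n` fibres
`m² + cΣ_μ(1 − ψ_μ(q)W_μ)^*(1 − ψ_μ(q)W_μ)`, commuting `W_μ` or not. [cite: King1986, (4.4) p.670, (4.35) p.674; Balaban1985BackgroundPropagators, (3.23) p.394; Balaban1984PropagatorsI, (1.29) p.23] -/
theorem re_quadForm_covLapF_kingConstLink_eq_fibre {W : Fin (d + 1) → Matrix n n ℂ} (hW : ∀ μ, W μ ∈ Matrix.unitaryGroup n ℂ) (c m2 : ℝ) (v : Tor K × n → ℂ) :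
    RCLike.re (star v ⬝ᵥ (covLapF K c m2 (kingConstLink K W) *ᵥ v))
      = ∑ q, (m2 * ‖fib K (vhat K v) q‖ ^ 2 + c * ∑ μ, ‖fib K (vhat K v) q - chi K q (unitVec K μ) • Matrix.toEuclideanLin (W μ) (fib K (vhat K v) q)‖ ^ 2) := by
  rw [re_quadForm_covLapF K c m2 (kingConstLink_mem_unitaryGroup K hW) v, ← sum_norm_fib_vhat_sq K v, Finset.sum_add_distrib, ← Finset.mul_sum, ← Finset.mul_sum,
    Finset.sum_comm (f := fun x μ => ‖fib K v x - Matrix.toEuclideanLin (kingConstLink K W (x, μ)) (fib K v (x + unitVec K μ))‖ ^ 2),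
    Finset.sum_comm (f := fun q μ => ‖fib K (vhat K v) q - chi K q (unitVec K μ) • Matrix.toEuclideanLin (W μ) (fib K (vhat K v) q)‖ ^ 2)]
  simp only [kingConstLink_apply, sum_norm_bond_sq_eq_fibre]

end Fibre

/-! ## §4 Fibrewise coercivity is torus coercivity -/

section Coercive

variable [hK : ∀ μ, NeZero (K μ)] {n : Type*} [Fintype n] [DecidableEq n]

/-- ★★ **FIBRE COERCIVITY ⟹ TORUS COERCIVITY**: if `κ‖ξ‖² ≤ m²‖ξ‖² + cΣ_μ‖ξ − ψ_μ(q)W_μξ‖²` for every momentum `q` and every `ξ ∈ ℂⁿ`, then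
`κ·Σ_x‖v_x‖² ≤ Re⟨v,(−cΔ_W+m²)v⟩` for every `v` on the torus — uniformly in the period vector. [cite: King1986, (4.4) p.670, (4.35) p.674; Balaban1985BackgroundPropagators, (3.39) p.397] -/
theorem coercive_covLapF_kingConstLink_of_fibre {W : Fin (d + 1) → Matrix n n ℂ} (hW : ∀ μ, W μ ∈ Matrix.unitaryGroup n ℂ) (c m2 : ℝ) {κ : ℝ}
    (hfib : ∀ (q : Tor K) (ξ : EuclideanSpace ℂ n), κ * ‖ξ‖ ^ 2 ≤ m2 * ‖ξ‖ ^ 2 + c * ∑ μ, ‖ξ - chi K q (unitVec K μ) • Matrix.toEuclideanLin (W μ) ξ‖ ^ 2)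
    (v : Tor K × n → ℂ) :
    κ * ∑ x, ‖fib K v x‖ ^ 2 ≤ RCLike.re (star v ⬝ᵥ (covLapF K c m2 (kingConstLink K W) *ᵥ v)) := by
  rw [re_quadForm_covLapF_kingConstLink_eq_fibre K hW, ← sum_norm_fib_vhat_sq K v, Finset.mul_sum]
  exact Finset.sum_le_sum fun q _ => hfib q _

/-- ★ Fibre coercivity ⟹ EVERY EIGENVALUE of `−cΔ_W + m²` is `≥ κ`, on every torus (PART Ϡ-c's engine). [cite: King1986, (4.4) p.670; Balaban1985BackgroundPropagators, (3.39) p.397] -/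
theorem eigenvalues_covLapF_kingConstLink_ge_of_fibre {W : Fin (d + 1) → Matrix n n ℂ} (hW : ∀ μ, W μ ∈ Matrix.unitaryGroup n ℂ) (c m2 : ℝ) {κ : ℝ}
    (hfib : ∀ (q : Tor K) (ξ : EuclideanSpace ℂ n), κ * ‖ξ‖ ^ 2 ≤ m2 * ‖ξ‖ ^ 2 + c * ∑ μ, ‖ξ - chi K q (unitVec K μ) • Matrix.toEuclideanLin (W μ) ξ‖ ^ 2)
    (i : Tor K × n) : κ ≤ (isHermitian_covLapF K c m2 (kingConstLink K W)).eigenvalues i :=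
  eigenvalues_covLapF_ge_of_coercive K c m2 _ (coercive_covLapF_kingConstLink_of_fibre K hW c m2 hfib) i

/-- ★ Fibre coercivity with `κ > 0` ⟹ `−cΔ_W + m²` IS POSITIVE DEFINITE on every torus. [cite: King1986, (4.4) p.670; Balaban1985BackgroundPropagators, (3.39) p.397] -/
theorem posDef_covLapF_kingConstLink_of_fibre {W : Fin (d + 1) → Matrix n n ℂ} (hW : ∀ μ, W μ ∈ Matrix.unitaryGroup n ℂ) (c m2 : ℝ) {κ : ℝ} (hκ : 0 < κ)
    (hfib : ∀ (q : Tor K) (ξ : EuclideanSpace ℂ n), κ * ‖ξ‖ ^ 2 ≤ m2 * ‖ξ‖ ^ 2 + c * ∑ μ, ‖ξ - chi K q (unitVec K μ) • Matrix.toEuclideanLin (W μ) ξ‖ ^ 2) :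
    (covLapF K c m2 (kingConstLink K W)).PosDef :=
  posDef_covLapF_of_coercive K c m2 _ hκ (coercive_covLapF_kingConstLink_of_fibre K hW c m2 hfib)

open scoped Matrix.Norms.L2Operator in
/-- ★ Fibre coercivity with `κ > 0` ⟹ `‖(−cΔ_W+m²)⁻¹‖_{ℓ²→ℓ²} ≤ κ⁻¹` on every torus. [cite: Balaban1985BackgroundPropagators, (3.39) p.397; King1986, (4.4) p.670] -/
theorem l2_opNorm_covLapF_kingConstLink_inv_le_of_fibre {W : Fin (d + 1) → Matrix n n ℂ} (hW : ∀ μ, W μ ∈ Matrix.unitaryGroup n ℂ) (c m2 : ℝ) {κ : ℝ} (hκ : 0 < κ)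
    (hfib : ∀ (q : Tor K) (ξ : EuclideanSpace ℂ n), κ * ‖ξ‖ ^ 2 ≤ m2 * ‖ξ‖ ^ 2 + c * ∑ μ, ‖ξ - chi K q (unitVec K μ) • Matrix.toEuclideanLin (W μ) ξ‖ ^ 2) :
    ‖(covLapF K c m2 (kingConstLink K W))⁻¹‖ ≤ κ⁻¹ :=
  l2_opNorm_covLapF_inv_le_of_coercive K c m2 _ hκ (coercive_covLapF_kingConstLink_of_fibre K hW c m2 hfib)

end Coercive

end Summit.QuantumFields.YangMills.BalabanUVNodes.N15KingModelRung.ConstantCurvature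

end
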